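import Literature.NumberTheory.Transcendental.Waldschmidt1980Setup
import Literature.NumberTheory.Transcendental.CijsouwWaldschmidt1977Delta
import HarnessLib

/-!
# Waldschmidt 1980, Lemma 2.4 over `ℚ`: point-independent denominators and sizes of the `Δ`-part

Support file (definitions and theorems only; no named facts) for the archimedean input of the
Stewart–Yu 1991 line of `Literature.Barriers.ABC.stewartYu1991_upperBound`, sequel to
`Waldschmidt1980Setup.lean` (M. Waldschmidt, *A lower bound for linear forms in logarithms*,
Acta Arith. **37** (1980), §3 over `ℚ` with `q = 2`).

Waldschmidt's Lemma 2.4 (= Cijsouw–Waldschmidt 1977, Lemma 3; p. 261–262): with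
`ν(k) = lcm(1, 2, …, k)`, for `qx` a positive integer
`q^{2kl} ν(k)^m (1/m!) Δ(x; k; l; m)` is an integer, `ν(k) ≤ 3ᵏ`. The point here, compared with
Baker's Lemma 1 of Ch. 3 (`ν(x; k) = lcm(x+1, …, x+k)`, the tree's `BakerQuantDelta.nuBound x h`),
is that the denominator of the DERIVATIVES does not depend on the point `x`: in Waldschmidt's §3
the derivative orders go up to `T` and the points up to `2^{J₀} S`, and only `log ν ≪ h` (rather
than `h log((x+h)/h)`) is affordable ((3.18), p. 266). In the finest-lattice convention of
`Waldschmidt1980Setup` all evaluation points are natural numbers, so only the `ν(k)^m` part is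
needed (no `q^{2kl}`).

## Contents (everything proved)

* `nu h = ∏_{p ≤ h} p^{[log_p h]}` (`= lcm(1,…,h) = nuBound 0 h`), `dvd_nu` (`j ∣ ν` for
  `1 ≤ j ≤ h`), `log_nu_le` (`log ν ≤ 6h`), and the arithmetic heart
  `mul_choose_dvd_nu`: **`i · binom(k, i) ∣ ν(h)`** for `1 ≤ i ≤ k ≤ h` (Kummer: the carries in
  `i + (k − i)` avoid the `v_p(i)` lowest digits, `factorization_choose_add_factorization_le_log`).
* `factorial_dvd_nu_pow_mul_blockProd` — **the block lemma**: for `R ⊆ {0,…,k−1}`,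
  `k! ∣ ν^{#R} ∏_{i ∉ R} (x + i + 1)` (induction on `#R`: one removed factor by the previous
  divisibility, two removed factors `i ≠ j` by `(j − i) ∏_{∉R} = ∏_{∉R∖j} − ∏_{∉R∖i}` and
  `j − i ∣ ν`).
* `NuIntegral ν P` (`ν^m ((1/m!)dᵐP)(x) ∈ ℤ` for all `m, x ∈ ℕ`), stable under products
  (Leibniz for Hasse derivatives), true for the blocks `Δ(X; k) = (1/k!)∏(X + i)`, `k ≤ h`, hence
  for `wPolyQ a b h = Δ(X;a)Δ(X;h)ᵇ` (`a ≤ h`) and its scalings `w(cX)`; in terms of the value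
  factor of `Waldschmidt1980Setup`: `exists_int_nu_pow_mul_pvQ` — **`ν^k · pvQ c (a,b) k x ∈ ℤ`**.
* sizes: `norm_pv_le` — `|pv c (a,b) k z| ≤ k! cᵏ 2^{a+bh} (e(⌈c|z|⌉+h)/h)^{h(b+1)}` (from the
  tree's `CW77.norm_hasseDeriv_wPoly_eval_le_exp`), and the degree / independence facts of the
  family `(a,b) ↦ w_{a,b}(cX)` used by the endgame (`natDegree_wScaled`, `wScaled_ne_zero`,
  `injective_natDegree_wScaled`).

## References

* [Waldschmidt1980] M. Waldschmidt, *A lower bound for linear forms in logarithms*, Acta Arith. 37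
  (1980), 257–283 — Lemma 2.4 (pp. 261–262), (3.17)–(3.18) (p. 266).
* [CijsouwWaldschmidt1977] P. L. Cijsouw, M. Waldschmidt, Compositio Math. 34 (1977) — Lemma 3
  (pp. 180–181).
* [BakerTNT1975] A. Baker, *Transcendental Number Theory* (1975), Ch. 3 §2 Lemma 1 (the tree's
  `BakerQuantDelta.lean`).
-/

noncomputable section

open Finset Polynomial
open Literature.NumberTheory.Transcendental.Baker1975.Ch3

namespace Literature.NumberTheory.Transcendental.Waldschmidt1980

/-! ### `ν(h) = lcm(1, …, h)` as a product of prime powers -/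

/-- `ν(h) = ∏_{p ≤ h prime} p^{[log_p h]}` (`= lcm(1, …, h)`; Waldschmidt's `ν(k)`, Lemma 2.4).
[cite: Waldschmidt1980, Lemma 2.4 (p. 261)] -/
def nu (h : ℕ) : ℕ := ∏ p ∈ Nat.primesBelow (h + 1), p ^ Nat.log p h

/-- `ν(h) = nuBound 0 h` (Baker's `ν(x; h)` at `x = 0`). [folklore] -/
theorem nu_eq_nuBound (h : ℕ) : nu h = nuBound 0 h := by
  simp [nu, nuBound]

/-- `0 < ν(h)`. [folklore] -/
theorem nu_pos (h : ℕ) : 0 < nu h := by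
  rw [nu_eq_nuBound]; exact nuBound_pos 0 h

/-- **`j ∣ ν(h)` for `1 ≤ j ≤ h`.** [cite: Waldschmidt1980, Lemma 2.4 (p. 261)] -/
theorem dvd_nu {h j : ℕ} (hj1 : 1 ≤ j) (hjh : j ≤ h) : j ∣ nu h := by
  rw [nu_eq_nuBound]
  simpa using dvd_nuBound (x := 0) hj1 hjh

/-- `ν` is monotone for divisibility: `ν(k) ∣ ν(h)` for `k ≤ h`. [folklore] -/
theorem nu_dvd_nu {k h : ℕ} (hkh : k ≤ h) : nu k ∣ nu h := by
  unfold nu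
  have hsub : Nat.primesBelow (k + 1) ⊆ Nat.primesBelow (h + 1) := by
    intro p hp
    rw [Nat.mem_primesBelow] at hp ⊢
    exact ⟨by omega, hp.2⟩
  refine (Finset.prod_dvd_prod_of_dvd _ _ fun p _ => pow_dvd_pow p (Nat.log_mono_right hkh)).trans ?_
  exact Finset.prod_dvd_prod_of_subset _ _ _ hsub

/-- **`log ν(h) ≤ 6h`** (from the tree's `log_nuBound_le`; Waldschmidt: `ν(k) ≤ 3ᵏ`). [cite: Waldschmidt1980, Lemma 2.4 (p. 262)] -/
theorem log_nu_le {h : ℕ} (hh : 2 ≤ h) : Real.log (nu h) ≤ 6 * h := by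
  have h1 := log_nuBound_le (x := 0) hh
  rw [nu_eq_nuBound]
  have h2 : Real.log (((0 : ℕ) + h : ℝ) / h) = 0 := by
    rw [Nat.cast_zero, zero_add, div_self (by positivity), Real.log_one]
  have h3 : Real.log (nuBound 0 h) ≤ h * 6 := by simpa [h2] using h1
  linarith

/-- `ν(h) ≤ e^{6h}` (`h ≥ 2`). [cite: Waldschmidt1980, Lemma 2.4 (p. 262)] -/
theorem nu_le_exp {h : ℕ} (hh : 2 ≤ h) : (nu h : ℝ) ≤ Real.exp (6 * h) := by
  have h0 : (0 : ℝ) < nu h := by exact_mod_cast nu_pos h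
  calc (nu h : ℝ) = Real.exp (Real.log (nu h)) := (Real.exp_log h0).symm
    _ ≤ Real.exp (6 * h) := Real.exp_le_exp.mpr (log_nu_le hh)

/-! ### Kummer: `i · binom(k, i) ∣ ν` -/

/-- **Kummer's theorem, sharpened by the trailing digits**: for a prime `p` and `0 < i ≤ k`,
`v_p(binom(k, i)) + v_p(i) ≤ [log_p k]` (the carries when adding `i` and `k − i` in base `p`
cannot occur at the `v_p(i)` lowest positions, where the digits of `i` vanish). [folklore] -/
theorem factorization_choose_add_factorization_le_log {p k i : ℕ} (hp : p.Prime) (hik : i ≤ k)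
    (hi : 0 < i) : (k.choose i).factorization p + i.factorization p ≤ Nat.log p k := by
  set b := Nat.log p k + 1 with hb
  have hdisj : Disjoint {j ∈ Ico 1 b | p ^ j ≤ i % p ^ j + (k - i) % p ^ j}
      {j ∈ Ico 1 b | p ^ j ∣ i} := by
    simp +contextual [Finset.disjoint_right, Nat.dvd_iff_mod_eq_zero,
      Nat.mod_lt _ (pow_pos hp.pos _)]
  have hib : i < p ^ b := lt_of_le_of_lt hik (Nat.lt_pow_succ_log_self hp.one_lt k)
  rw [Nat.factorization_choose hp hik (Nat.lt_succ_self _),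
    Nat.factorization_eq_card_pow_dvd_of_lt hp hi hib, ← card_union_of_disjoint hdisj,
    filter_union_right]
  have hle := (Ico 1 b).card_filter_le
    fun x => p ^ x ≤ i % p ^ x + (k - i) % p ^ x ∨ p ^ x ∣ i
  rw [Nat.card_Ico] at hle
  omega

/-- **`i · binom(k, i) ∣ ν(h)` for `1 ≤ i ≤ k ≤ h`** — the arithmetic fact behind the
point-independence of Waldschmidt's denominators. [cite: Waldschmidt1980, Lemma 2.4 (p. 261)] -/
theorem mul_choose_dvd_nu {h k i : ℕ} (hi1 : 1 ≤ i) (hik : i ≤ k) (hkh : k ≤ h) :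
    i * k.choose i ∣ nu h := by
  classical
  refine (?_ : i * k.choose i ∣ nu k).trans (nu_dvd_nu hkh)
  set y := i * k.choose i with hy
  have hy0 : y ≠ 0 := Nat.mul_ne_zero (by omega) (Nat.choose_pos hik).ne'
  rw [← Nat.prod_factorization_pow_eq_self hy0]
  -- each prime power `p^{v_p y}` divides `ν(k)`
  have hdvd : ∀ p ∈ y.factorization.support, p ^ y.factorization p ∣ nu k := by
    intro p hp
    have hpp : p.Prime := Nat.prime_of_mem_primeFactors (by simpa using hp)
    have hv : y.factorization p ≤ Nat.log p k := by
      rw [hy, Nat.factorization_mul (by omega) (Nat.choose_pos hik).ne', Finsupp.add_apply,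
        add_comm]
      exact factorization_choose_add_factorization_le_log hpp hik (by omega)
    have hpk : p ≤ k := by
      -- `p ∣ y` forces `v_p y ≥ 1`, hence `log_p k ≥ 1`, hence `p ≤ k`
      have h1 : 1 ≤ y.factorization p := by
        rw [Finsupp.mem_support_iff] at hp; omega
      have h2 : 1 ≤ Nat.log p k := h1.trans hv
      by_contra hlt
      push Not at hlt
      have : Nat.log p k = 0 := Nat.log_of_lt hlt
      omega
    have hmem : p ∈ Nat.primesBelow (k + 1) := Nat.mem_primesBelow.mpr ⟨by omega, hpp⟩
    unfold nu
    exact (pow_dvd_pow p hv).trans (Finset.dvd_prod_of_mem (fun p => p ^ Nat.log p k) hmem)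
  have hcop : ∀ p ∈ y.factorization.support, ∀ q ∈ y.factorization.support, p ≠ q →
      Nat.Coprime (p ^ y.factorization p) (q ^ y.factorization q) := by
    intro p hp q hq hpq
    have hpp : p.Prime := Nat.prime_of_mem_primeFactors (by simpa using hp)
    have hqq : q.Prime := Nat.prime_of_mem_primeFactors (by simpa using hq)
    exact Nat.Coprime.pow _ _ ((Nat.coprime_primes hpp hqq).mpr hpq)
  rw [Finsupp.prod]
  have key : ∀ s : Finset ℕ, s ⊆ y.factorization.support →
      ∏ p ∈ s, p ^ y.factorization p ∣ nu k := by
    intro s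
    induction s using Finset.induction_on with
    | empty => intro; simp
    | insert a s has ih =>
      intro hs
      rw [Finset.prod_insert has]
      refine Nat.Coprime.mul_dvd_of_dvd_of_dvd ?_ (hdvd a (hs (Finset.mem_insert_self a s)))
        (ih fun q hq => hs (Finset.mem_insert_of_mem hq))
      refine Nat.Coprime.prod_right fun q hq => hcop a (hs (Finset.mem_insert_self a s)) q
        (hs (Finset.mem_insert_of_mem hq)) ?_
      rintro rfl; exact has hq
  exact key _ le_rfl

/-! ### The block lemma: `k! ∣ ν^{#R} ∏_{i ∉ R} (x + i + 1)` -/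

/-- The product of the kept linear factors of one block `X+1, …, X+k` at the natural point `x`.
[cite: Waldschmidt1980, Lemma 2.4 (p. 261)] -/
def blockProd (k x : ℕ) (R : Finset (Fin k)) : ℕ := ∏ i ∈ univ \ R, (x + i + 1)

/-- `blockProd` with nothing removed is `(x+1)⋯(x+k)`, a multiple of `k!`. [folklore] -/
theorem factorial_dvd_blockProd_empty (k x : ℕ) : k.factorial ∣ blockProd k x ∅ := by
  unfold blockProd
  rw [sdiff_empty, Fin.prod_univ_eq_prod_range (fun i => x + i + 1) k]
  have h : ∏ i ∈ range k, (x + i + 1) = (x + 1).ascFactorial k := by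
    rw [Nat.ascFactorial_eq_prod_range]
    exact Finset.prod_congr rfl fun i _ => by ring
  rw [h]
  exact Nat.factorial_dvd_ascFactorial _ _

/-- Removing one more factor: `(x + j + 1) · blockProd (insert j R) = blockProd R` for `j ∉ R`.
[folklore] -/
theorem mul_blockProd_insert {k x : ℕ} {R : Finset (Fin k)} {j : Fin k} (hj : j ∉ R) :
    (x + j + 1) * blockProd k x (insert j R) = blockProd k x R := by
  unfold blockProd
  have hmem : j ∈ univ \ R := by simp [hj]
  rw [← Finset.mul_prod_erase _ _ hmem]
  congr 1
  refine Finset.prod_congr ?_ fun _ _ => rfl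
  ext i
  simp only [mem_sdiff, mem_univ, true_and, mem_insert, mem_erase, ne_eq]
  tauto

/-- **One removed factor**: `k! ∣ ν(h) · ∏_{i ≠ j} (x + i + 1)` for `k ≤ h` — from
`(j+1) binom(k, j+1) ∣ ν` and `(x+1)⋯(x+j) · (x+j+2)⋯(x+k) = j! binom(x+j, j) (k−1−j)! binom(x+k, k−1−j)`.
[cite: Waldschmidt1980, Lemma 2.4 (p. 261)] -/
theorem factorial_dvd_nu_mul_blockProd_singleton {h k x : ℕ} (hkh : k ≤ h) (j : Fin k) :
    k.factorial ∣ nu h * blockProd k x {j} := by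
  have hj := j.isLt
  set v : ℕ := (j : ℕ) + 1 with hv
  -- the kept product splits at `j`
  have hsplit : blockProd k x {j} =
      (∏ i ∈ range (j : ℕ), (x + i + 1)) * ∏ i ∈ Ico ((j : ℕ) + 1) k, (x + i + 1) := by
    unfold blockProd
    have h1 : ∏ i ∈ univ \ ({j} : Finset (Fin k)), (x + (i : ℕ) + 1) =
        ∏ i ∈ (range k).erase (j : ℕ), (x + i + 1) := by
      rw [← Finset.prod_image (s := univ \ ({j} : Finset (Fin k))) (g := fun i : Fin k => (i : ℕ))
        (f := fun i : ℕ => x + i + 1) (fun a _ b _ hab => Fin.ext hab)]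
      refine Finset.prod_congr ?_ fun _ _ => rfl
      ext i
      simp only [mem_image, mem_sdiff, mem_univ, mem_singleton, true_and, mem_erase, ne_eq,
        mem_range]
      constructor
      · rintro ⟨a, ha, rfl⟩
        exact ⟨fun e => ha (Fin.ext e), a.isLt⟩
      · rintro ⟨hne, hlt⟩
        exact ⟨⟨i, hlt⟩, fun e => hne (congrArg Fin.val e), rfl⟩
    rw [h1]
    have h2 : (range k).erase (j : ℕ) = range (j : ℕ) ∪ Ico ((j : ℕ) + 1) k := by
      ext i
      simp only [mem_erase, ne_eq, mem_range, mem_union, mem_Ico]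
      omega
    rw [h2, Finset.prod_union]
    exact Finset.disjoint_left.mpr fun i hi hi' => by
      simp only [mem_range] at hi; simp only [mem_Ico] at hi'; omega
  -- the two pieces as ascending factorials
  have hleft : ∏ i ∈ range (j : ℕ), (x + i + 1) = (j : ℕ).factorial * (x + j).choose j := by
    rw [← Nat.ascFactorial_eq_factorial_mul_choose, Nat.ascFactorial_eq_prod_range]
    exact Finset.prod_congr rfl fun i _ => by ring
  have hright : ∏ i ∈ Ico ((j : ℕ) + 1) k, (x + i + 1) =
      (k - 1 - j).factorial * (x + k).choose (k - 1 - j) := by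
    have h1 : ∏ i ∈ Ico ((j : ℕ) + 1) k, (x + i + 1) = (x + j + 2).ascFactorial (k - 1 - j) := by
      rw [Nat.ascFactorial_eq_prod_range, Finset.prod_Ico_eq_prod_range]
      have : k - ((j : ℕ) + 1) = k - 1 - j := by omega
      rw [this]
      exact Finset.prod_congr rfl fun i _ => by ring
    rw [h1, show x + (j : ℕ) + 2 = (x + j + 1) + 1 by ring, Nat.ascFactorial_eq_factorial_mul_choose]
    congr 2; omega
  -- `k! = v binom(k,v) · (v-1)! (k-v)!`
  have hfact : k.factorial = v * k.choose v * ((j : ℕ).factorial * (k - 1 - j).factorial) := by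
    have h1 := Nat.choose_mul_factorial_mul_factorial (show v ≤ k by omega)
    have h2 : v.factorial = v * (j : ℕ).factorial := by rw [hv]; exact Nat.factorial_succ _
    have h3 : k - v = k - 1 - j := by omega
    rw [← h1, h2, h3]; ring
  rw [hsplit, hleft, hright, hfact]
  have hdvd : v * k.choose v ∣ nu h := mul_choose_dvd_nu (by omega) (by omega) hkh
  obtain ⟨t, ht⟩ := hdvd
  rw [ht]
  exact ⟨t * ((x + j).choose j * (x + k).choose (k - 1 - j)), by ring⟩

/-- **The block lemma** (point-independent form of Waldschmidt's Lemma 2.4 for one block): for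
every set `R` of removed factors, `k! ∣ ν(h)^{#R} · ∏_{i ∉ R} (x + i + 1)` (`k ≤ h`).
[cite: Waldschmidt1980, Lemma 2.4 (p. 261)] -/
theorem factorial_dvd_nu_pow_mul_blockProd {h k x : ℕ} (hkh : k ≤ h) :
    ∀ (m : ℕ) (R : Finset (Fin k)), R.card = m → k.factorial ∣ nu h ^ m * blockProd k x R := by
  intro m
  induction m using Nat.strong_induction_on with
  | _ m ih =>
    intro R hR
    rcases Nat.lt_or_ge m 2 with hm | hm
    · interval_cases m
      · rw [Finset.card_eq_zero] at hR
        subst hR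
        simpa using factorial_dvd_blockProd_empty k x
      · obtain ⟨j, rfl⟩ := Finset.card_eq_one.mp hR
        simpa using factorial_dvd_nu_mul_blockProd_singleton (x := x) hkh j
    · -- two distinct removed factors `i < j`
      have hcard : 1 < R.card := by omega
      obtain ⟨a, ha, b, hb, hab⟩ := Finset.one_lt_card.mp hcard
      -- order them
      obtain ⟨i, hi, j, hj, hij⟩ : ∃ i ∈ R, ∃ j ∈ R, (i : ℕ) < (j : ℕ) := by
        rcases lt_or_gt_of_ne (fun e : (a : ℕ) = b => hab (Fin.ext e)) with h | h
        · exact ⟨a, ha, b, hb, h⟩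
        · exact ⟨b, hb, a, ha, h⟩
      have hine : i ≠ j := fun e => by subst e; exact lt_irrefl _ hij
      -- `R = insert j (R.erase j)` etc.
      have hRj : blockProd k x (R.erase j) = (x + j + 1) * blockProd k x R := by
        conv_rhs => rw [← Finset.insert_erase hj]
        rw [mul_blockProd_insert (Finset.notMem_erase j R)]
      have hRi : blockProd k x (R.erase i) = (x + i + 1) * blockProd k x R := by
        conv_rhs => rw [← Finset.insert_erase hi]
        rw [mul_blockProd_insert (Finset.notMem_erase i R)]
      have hcj : (R.erase j).card = m - 1 := by rw [Finset.card_erase_of_mem hj, hR]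
      have hci : (R.erase i).card = m - 1 := by rw [Finset.card_erase_of_mem hi, hR]
      have h1 := ih (m - 1) (by omega) (R.erase j) hcj
      have h2 := ih (m - 1) (by omega) (R.erase i) hci
      rw [hRj] at h1
      rw [hRi] at h2
      -- `k! ∣ ν^{m-1} ((x+j+1) - (x+i+1)) P = ν^{m-1} (j - i) P`
      have h3 : k.factorial ∣ nu h ^ (m - 1) * ((x + j + 1) * blockProd k x R) -
          nu h ^ (m - 1) * ((x + i + 1) * blockProd k x R) := Nat.dvd_sub h1 h2
      have h4 : nu h ^ (m - 1) * ((x + j + 1) * blockProd k x R) -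
          nu h ^ (m - 1) * ((x + i + 1) * blockProd k x R) =
          ((j : ℕ) - i) * (nu h ^ (m - 1) * blockProd k x R) := by
        rw [← Nat.mul_sub, ← Nat.sub_mul]
        have : x + (j : ℕ) + 1 - (x + i + 1) = (j : ℕ) - i := by omega
        rw [this]; ring
      rw [h4] at h3
      -- `j - i ∣ ν`
      have hd : ((j : ℕ) - i) ∣ nu h := dvd_nu (by omega) (by have := j.isLt; omega)
      obtain ⟨t, ht⟩ := hd
      have hm1 : m = (m - 1) + 1 := by omega
      rw [hm1, pow_succ]
      have hgoal : nu h ^ (m - 1) * nu h * blockProd k x R =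
          t * (((j : ℕ) - i) * (nu h ^ (m - 1) * blockProd k x R)) := by
        conv_lhs => rw [show nu h ^ (m - 1) * nu h = nu h ^ (m - 1) * (((j : ℕ) - i) * t) from by
          rw [← ht]]
        ring
      rw [hgoal]
      exact h3.mul_left t

/-! ### `ν`-integrality of Hasse derivatives at natural points -/

/-- The property "`ν^m · ((1/m!) dᵐ P)(x)` is an integer for all orders `m` and all natural points
`x`" of a rational polynomial `P` (Waldschmidt's Lemma 2.4 says this for `P = Δ(X; k)ˡ`,
`ν = ν(k)`). [cite: Waldschmidt1980, Lemma 2.4 (p. 262)] -/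
def NuIntegral (ν : ℕ) (P : ℚ[X]) : Prop :=
  ∀ m x : ℕ, ∃ z : ℤ, ((ν : ℚ) ^ m) * (hasseDeriv m P).eval (x : ℚ) = z

/-- `1` is `ν`-integral. [folklore] -/
theorem NuIntegral.one (ν : ℕ) : NuIntegral ν 1 := by
  intro m x
  rcases Nat.eq_zero_or_pos m with rfl | hm
  · exact ⟨1, by simp⟩
  · exact ⟨0, by simp [hasseDeriv_apply_one m hm]⟩

/-- **Leibniz**: a product of `ν`-integral polynomials is `ν`-integral
(`(1/m!)dᵐ(PQ) = ∑_{i+j=m} (1/i!)dⁱP · (1/j!)dʲQ`). [folklore] -/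
theorem NuIntegral.mul {ν : ℕ} {P Q : ℚ[X]} (hP : NuIntegral ν P) (hQ : NuIntegral ν Q) :
    NuIntegral ν (P * Q) := by
  intro m x
  classical
  have h : ∀ ij ∈ antidiagonal m, ∃ z : ℤ,
      (ν : ℚ) ^ m * ((hasseDeriv ij.1 P).eval (x : ℚ) * (hasseDeriv ij.2 Q).eval (x : ℚ)) = z := by
    intro ij hij
    obtain ⟨z₁, h₁⟩ := hP ij.1 x
    obtain ⟨z₂, h₂⟩ := hQ ij.2 x
    refine ⟨z₁ * z₂, ?_⟩
    have hm : m = ij.1 + ij.2 := (Finset.HasAntidiagonal.mem_antidiagonal.mp hij).symm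
    rw [hm, pow_add]
    push_cast
    rw [← h₁, ← h₂]
    ring
  choose z hz using h
  refine ⟨∑ ij ∈ (antidiagonal m).attach, z ij.1 ij.2, ?_⟩
  rw [hasseDeriv_mul, eval_finsetSum, Finset.mul_sum, ← Finset.sum_attach]
  push_cast
  refine Finset.sum_congr rfl fun ij _ => ?_
  rw [eval_mul]
  exact hz ij.1 ij.2

/-- Powers of a `ν`-integral polynomial are `ν`-integral. [folklore] -/
theorem NuIntegral.pow {ν : ℕ} {P : ℚ[X]} (hP : NuIntegral ν P) : ∀ n : ℕ, NuIntegral ν (P ^ n)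
  | 0 => by simpa using NuIntegral.one ν
  | n + 1 => by rw [pow_succ]; exact (NuIntegral.pow hP n).mul hP

section Scaling

variable {R : Type*} [CommRing R]

/-- `dᵐ (w(cX)) = cᵐ (dᵐ w)(cX)` over any commutative ring (the tree's
`CW77.iterate_derivative_comp_C_mul_X` is the case `R = ℂ`). [folklore] -/
theorem iterate_derivative_comp_C_mul_X' (w : R[X]) (c : R) (m : ℕ) :
    derivative^[m] (w.comp (C c * X)) = C (c ^ m) * (derivative^[m] w).comp (C c * X) := by
  induction m with
  | zero => simp
  | succ m ih =>
    rw [Function.iterate_succ_apply', ih, derivative_mul, derivative_C, zero_mul, zero_add,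
      derivative_comp, derivative_mul, derivative_C, zero_mul, zero_add, derivative_X, mul_one,
      Function.iterate_succ_apply', pow_succ, C_mul]
    ring

/-- `(dᵘ w)(z) = μ! · ((1/μ!) dᵘ w)(z)` (formal vs. Hasse derivatives) over any commutative ring.
[folklore] -/
theorem iterate_derivative_eval_eq_factorial_mul_hasseDeriv_eval (w : R[X]) (μ : ℕ) (z : R) :
    (derivative^[μ] w).eval z = (μ.factorial : R) * (hasseDeriv μ w).eval z := by
  have h := congrFun (factorial_smul_hasseDeriv (R := R) μ) w
  simp only [LinearMap.smul_apply] at h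
  rw [← h, eval_smul, nsmul_eq_mul]

end Scaling

/-- **Hasse derivatives of a rescaled rational polynomial at a point**:
`((1/m!)dᵐ (w(cX)))(x) = cᵐ ((1/m!)dᵐ w)(cx)` (the tree's `CW77.hasseDeriv_comp_C_mul_X_eval` is
the case of `ℂ`). [folklore] -/
theorem hasseDeriv_comp_C_mul_X_eval' (w : ℚ[X]) (c x : ℚ) (m : ℕ) :
    (hasseDeriv m (w.comp (C c * X))).eval x = c ^ m * (hasseDeriv m w).eval (c * x) := by
  have hm : (m.factorial : ℚ) ≠ 0 := by exact_mod_cast (Nat.factorial_pos m).ne'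
  have h1 := iterate_derivative_eval_eq_factorial_mul_hasseDeriv_eval (w.comp (C c * X)) m x
  have h2 := iterate_derivative_eval_eq_factorial_mul_hasseDeriv_eval w m (c * x)
  rw [iterate_derivative_comp_C_mul_X', eval_mul, eval_C, eval_comp, eval_mul, eval_C, eval_X, h2]
    at h1
  have h3 : (m.factorial : ℚ) * ((hasseDeriv m (w.comp (C c * X))).eval x) =
      (m.factorial : ℚ) * (c ^ m * (hasseDeriv m w).eval (c * x)) := by
    rw [← h1]; ring
  exact mul_left_cancel₀ hm h3

/-- Rescaling by a natural number preserves `ν`-integrality (the points `c x` are again natural).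
[folklore] -/
theorem NuIntegral.comp_C_mul_X {ν : ℕ} {P : ℚ[X]} (hP : NuIntegral ν P) (c : ℕ) :
    NuIntegral ν (P.comp (C (c : ℚ) * X)) := by
  intro m x
  obtain ⟨z, hz⟩ := hP m (c * x)
  refine ⟨c ^ m * z, ?_⟩
  rw [hasseDeriv_comp_C_mul_X_eval']
  push_cast at hz ⊢
  rw [← hz]
  ring

/-! ### The blocks `Δ(X; k)` and the family `Δ(X; a) Δ(X; h)ᵇ` -/

/-- **Feldman's polynomial `Δ(X; k) = (X+1)⋯(X+k)/k!` with rational coefficients.**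
[cite: Waldschmidt1980, Lemma 2.4 (p. 261)] -/
def deltaQ (k : ℕ) : ℚ[X] := C ((k.factorial : ℚ)⁻¹) * ∏ i : Fin k, (X + C (((i : ℕ) : ℚ) + 1))

/-- **Lemma 2.4, point-independent form, for one block**: `Δ(X; k)` is `ν(h)`-integral for
`k ≤ h`, i.e. `ν(h)^m ((1/m!) dᵐ Δ(·; k))(x) ∈ ℤ` for all `m` and all natural `x`.
[cite: Waldschmidt1980, Lemma 2.4 (p. 262)] -/
theorem nuIntegral_deltaQ {h k : ℕ} (hkh : k ≤ h) : NuIntegral (nu h) (deltaQ k) := by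
  intro m x
  classical
  unfold deltaQ
  rw [← smul_eq_C_mul, LinearMap.map_smul, eval_smul, smul_eq_mul]
  by_cases hm : m ≤ k
  · have hcard : m ≤ (univ : Finset (Fin k)).card := by simpa using hm
    rw [hasseDeriv_prod_X_add_C_eval univ (fun i : Fin k => ((i : ℕ) : ℚ) + 1) (x : ℚ) hcard]
    -- each subset contributes an integer
    have hterm : ∀ t ∈ (univ : Finset (Fin k)).powersetCard ((univ : Finset (Fin k)).card - m),
        ∃ z : ℤ, (nu h : ℚ) ^ m * (((k.factorial : ℚ)⁻¹) *
          ∏ i ∈ t, ((x : ℚ) + (((i : ℕ) : ℚ) + 1))) = z := by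
      intro t ht
      have htc : (univ \ t).card = m := by
        rw [Finset.card_sdiff_of_subset (Finset.subset_univ t)]
        have h1 := (Finset.mem_powersetCard.mp ht).2
        simp only [Finset.card_univ, Fintype.card_fin] at h1 ⊢
        omega
      obtain ⟨e, he⟩ := factorial_dvd_nu_pow_mul_blockProd (x := x) hkh m (univ \ t) htc
      refine ⟨(e : ℤ), ?_⟩
      have hprod : ∏ i ∈ t, ((x : ℚ) + (((i : ℕ) : ℚ) + 1)) =
          ((blockProd k x (univ \ t) : ℕ) : ℚ) := by
        unfold blockProd
        rw [sdiff_sdiff_right_self, Finset.inf_eq_inter, Finset.univ_inter]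
        push_cast
        exact prod_congr rfl fun i _ => by ring
      have hk0 : (k.factorial : ℚ) ≠ 0 := by exact_mod_cast (Nat.factorial_pos k).ne'
      have he' : ((nu h : ℚ)) ^ m * ((blockProd k x (univ \ t) : ℕ) : ℚ) = (k.factorial : ℚ) * e := by
        exact_mod_cast he
      rw [hprod, ← mul_assoc, mul_comm ((nu h : ℚ) ^ m), mul_assoc, he', ← mul_assoc,
        inv_mul_cancel₀ hk0, one_mul]
      norm_cast
    choose z hz using hterm
    refine ⟨∑ t ∈ ((univ : Finset (Fin k)).powersetCard ((univ : Finset (Fin k)).card - m)).attach,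
      z t.1 t.2, ?_⟩
    rw [Finset.mul_sum, Finset.mul_sum, ← Finset.sum_attach]
    push_cast
    exact Finset.sum_congr rfl fun t _ => hz t.1 t.2
  · have hlt : (univ : Finset (Fin k)).card < m := by simp; omega
    rw [hasseDeriv_prod_X_add_C_eq_zero univ _ hlt]
    exact ⟨0, by simp⟩

/-- **Lemma 2.4 for the whole `z₀`-polynomial**: `Δ(X; a) Δ(X; h)ᵇ` is `ν(h)`-integral for
`a ≤ h`. [cite: Waldschmidt1980, Lemma 2.4 (p. 262)] -/
theorem nuIntegral_deltaQ_mul_pow {a b h : ℕ} (hah : a ≤ h) :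
    NuIntegral (nu h) (deltaQ a * deltaQ h ^ b) :=
  (nuIntegral_deltaQ hah).mul ((nuIntegral_deltaQ le_rfl).pow b)

/-- `Δ(X;a)Δ(X;h)ᵇ = (a! h!ᵇ)⁻¹ ∏_{slots} (X + slotVal) = wPolyQ a b h` (the product over Baker's
`Slot a b h`). [folklore] -/
theorem deltaQ_mul_pow_eq_wPolyQ (a b h : ℕ) : deltaQ a * deltaQ h ^ b = wPolyQ a b h := by
  unfold deltaQ wPolyQ wDen
  rw [Fintype.prod_sum_type, Fintype.prod_prod_type]
  simp only [slotVal, Nat.cast_add, Nat.cast_one, Finset.prod_const, Finset.card_univ,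
    Fintype.card_fin]
  rw [Nat.cast_mul, Nat.cast_pow, mul_inv, ← inv_pow, C_mul, C_pow]
  ring

/-- **`wPolyQ a b h` is `ν(h)`-integral** (`a ≤ h`). [cite: Waldschmidt1980, Lemma 2.4 (p. 262)] -/
theorem nuIntegral_wPolyQ {a b h : ℕ} (hah : a ≤ h) : NuIntegral (nu h) (wPolyQ a b h) := by
  rw [← deltaQ_mul_pow_eq_wPolyQ]; exact nuIntegral_deltaQ_mul_pow hah

/-- … and so is `wScaled c a b h = w_{a,b}(cX)` for natural `c`. [cite: Waldschmidt1980, Lemma 2.4 (p. 262)] -/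
theorem nuIntegral_wScaled {a b h : ℕ} (hah : a ≤ h) (c : ℕ) : NuIntegral (nu h) (wScaled c a b h) :=
  (nuIntegral_wPolyQ hah).comp_C_mul_X c

/-- **The denominators of the value factor**: `ν(h)ᵏ · pvQ c (a,b) k x ∈ ℤ` for natural `x`
(`a < h`), i.e. Waldschmidt's (3.18) without the factor `(qLₙ)^{2(L₋₁+1)(L₀+1)}` (which the
finest-lattice convention makes unnecessary) and with `ν = lcm(1,…,h)` independent of the point.
[cite: Waldschmidt1980, (3.18) p. 266] -/
theorem exists_int_nu_pow_mul_pvQ {h L₀ : ℕ} (c : ℕ) (ab : Fin h × Fin (L₀ + 1)) (k x : ℕ) :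
    ∃ z : ℤ, ((nu h : ℚ) ^ k) * pvQ c ab k (x : ℚ) = z := by
  have hah : (ab.1 : ℕ) ≤ h := ab.1.isLt.le
  obtain ⟨z, hz⟩ := nuIntegral_wScaled hah c (b := (ab.2 : ℕ)) k x
  refine ⟨k.factorial * z, ?_⟩
  unfold pvQ
  rw [iterate_derivative_eval_eq_factorial_mul_hasseDeriv_eval]
  push_cast
  rw [← hz]
  ring

/-! ### Sizes of the value factor and the shape of the family `(a, b) ↦ w_{a,b}(cX)` -/

/-- `wScaled ↦ wPoly ∘ (cX)` under `ℚ[X] → ℂ[X]`. [folklore] -/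
theorem map_wScaled (c a b h : ℕ) :
    (wScaled c a b h).map (algebraMap ℚ ℂ) = (wPoly a b h).comp (C (c : ℂ) * X) := by
  unfold wScaled
  rw [Polynomial.map_comp, map_wPolyQ, Polynomial.map_mul, Polynomial.map_C, Polynomial.map_X]
  simp

/-- **The size of the value factor** (Waldschmidt's (3.17), `|Δ(z + λ₋₁; L₋₁+1; λ₀+1; t)| ≤
exp(f₁U/qⁿD)`, in closed form): for `a ≤ h`, `1 ≤ h`,
`|pv c (a,b) k z| ≤ k! cᵏ 2^{a+bh} (e(⌈c|z|⌉+h)/h)^{h(b+1)}` (the tree's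
`CW77.norm_hasseDeriv_wPoly_eval_le_exp` at the point `cz`). [cite: Waldschmidt1980, (3.17) p. 266] -/
theorem norm_pv_le {h L₀ : ℕ} (hh : 1 ≤ h) (c : ℕ) (ab : Fin h × Fin (L₀ + 1)) (k : ℕ) (z : ℂ) :
    ‖pv c ab k z‖ ≤ k.factorial * (c : ℝ) ^ k * (2 ^ ((ab.1 : ℕ) + (ab.2 : ℕ) * h) *
      (Real.exp 1 * (⌈(c : ℝ) * ‖z‖⌉₊ + h) / h) ^ (h * ((ab.2 : ℕ) + 1))) := by
  have hah : (ab.1 : ℕ) ≤ h := ab.1.isLt.le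
  unfold pv
  rw [map_wScaled, iterate_derivative_eval_eq_factorial_mul_hasseDeriv_eval,
    CW77.hasseDeriv_comp_C_mul_X_eval, norm_mul, norm_mul, Complex.norm_natCast, norm_pow,
    Complex.norm_natCast]
  have hb := CW77.norm_hasseDeriv_wPoly_eval_le_exp (b := (ab.2 : ℕ)) hah hh ((c : ℂ) * z) k
  rw [norm_mul, Complex.norm_natCast] at hb
  rw [mul_assoc]
  exact mul_le_mul_of_nonneg_left (mul_le_mul_of_nonneg_left hb (by positivity)) (by positivity)

/-- `wPolyQ a b h ≠ 0`. [folklore] -/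
theorem wPolyQ_ne_zero (a b h : ℕ) : wPolyQ a b h ≠ 0 := by
  intro h0
  have h1 := map_wPolyQ a b h
  rw [h0, Polynomial.map_zero] at h1
  exact wPoly_ne_zero a b h h1.symm

/-- `deg wPolyQ a b h = a + bh`. [folklore] -/
theorem natDegree_wPolyQ (a b h : ℕ) : (wPolyQ a b h).natDegree = a + b * h := by
  rw [← natDegree_wPoly a b h, ← map_wPolyQ,
    natDegree_map_eq_of_injective (algebraMap ℚ ℂ).injective]

/-- `w_{a,b}(cX) ≠ 0` for `c ≠ 0`. [folklore] -/
theorem wScaled_ne_zero {c : ℕ} (hc : c ≠ 0) (a b h : ℕ) : wScaled c a b h ≠ 0 := by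
  unfold wScaled
  intro h0
  rcases Polynomial.comp_eq_zero_iff.mp h0 with h1 | ⟨_, h2⟩
  · exact wPolyQ_ne_zero a b h h1
  · have h3 := congrArg (fun q : ℚ[X] => q.coeff 1) h2
    simp only [coeff_C_mul, coeff_X_one, mul_one, coeff_C, one_ne_zero, if_false] at h3
    exact hc (by exact_mod_cast h3)

/-- `deg w_{a,b}(cX) = a + bh` for `c ≠ 0`. [folklore] -/
theorem natDegree_wScaled {c : ℕ} (hc : c ≠ 0) (a b h : ℕ) :
    (wScaled c a b h).natDegree = a + b * h := by
  unfold wScaled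
  rw [Polynomial.natDegree_comp, natDegree_wPolyQ, natDegree_C_mul_X _ (by exact_mod_cast hc),
    mul_one]

/-- **The degrees `a + bh` (`a < h`) are pairwise distinct**: the family
`(a, b) ↦ w_{a,b}(cX)` is triangular, hence linearly independent (this is how Lemma 2.4's last
assertion — the linear independence of the `Δ(z + r; k)ˡ` — is used in §3.5).
[cite: Waldschmidt1980, Lemma 2.4 (p. 262)] -/
theorem injective_natDegree_wScaled {c : ℕ} (hc : c ≠ 0) (h L₀ : ℕ) :
    Function.Injective fun ab : Fin h × Fin (L₀ + 1) => (wScaled c ab.1 ab.2 h).natDegree := by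
  intro ab ab' hab
  simp only [natDegree_wScaled hc] at hab
  have ha := ab.1.isLt
  have ha' := ab'.1.isLt
  have hpos : 0 < h := by omega
  have hdiv : (ab.2 : ℕ) = (ab'.2 : ℕ) := by
    have h1 : ((ab.1 : ℕ) + (ab.2 : ℕ) * h) / h = ((ab'.1 : ℕ) + (ab'.2 : ℕ) * h) / h := by rw [hab]
    rwa [Nat.add_mul_div_right _ _ hpos, Nat.add_mul_div_right _ _ hpos,
      Nat.div_eq_of_lt ha, Nat.div_eq_of_lt ha', zero_add, zero_add] at h1
  have hmod : (ab.1 : ℕ) = (ab'.1 : ℕ) := by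
    rw [hdiv] at hab; omega
  exact Prod.ext (Fin.ext hmod) (Fin.ext hdiv)

end Literature.NumberTheory.Transcendental.Waldschmidt1980

end
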